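import Summits.AtomisticToContinuum.HydrodynamicLimit.Theorems.RelayRaceLocalityNearConstantShortTimeHLTiltL2ContTiltTools
import HarnessLib

/-!
# Crux `NearConstantShortTimeHL` (stmt-AtomisticToContinuum-12502), line `small-tilt-domination`, skeleton v16 —
# registered helper `tl_contTilt_of : VarianceL2 → OnePointUniform → ContTiltLogLaplace` (the TILTING step of the L² route)

Support file (`--supports stmt-AtomisticToContinuum-12502`; file 2 of 2, tools in `…TiltL2ContTiltTools.lean`). The log-Laplace
bound for CONTINUOUS tilts `|G| ≤ 1` of the matched canonical dilute hard-sphere gas from the two finite-`(ε, n)` inputs of the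
L² route: `VarianceL2` (under the tilted activities `a e^{tG}`, continuous and still dilute: `sup β_t ≤ 2e^{1/4} η₁/σ³`) bounds
`m′(t) = n⁻¹ Var_t` (`hasDerivAt_tilted_mean`, `tlt_exp_moment_le`), and `OnePointUniform` centres `m(0) = M^G(n)/Ξ(n)` of the
matched profile `profileOf (thermoActivity σ ρ₁)` (statics regime, `ρ_lim = ρ₁`, `thermoActivity_spec`) at `I(G) = ∫ G ρ₁`
(`Ilim_eq_integral`), uniformly over the class: the Lipschitz constant of `β = a/∫a` is bounded on the class through the
Lipschitz insertion factor (`stub_eosRatioAnalytic`, `tlt_package`).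
References: H.-T. Yau, Lett. Math. Phys. 22 (1991) §2; E. Pulvirenti – D. Tsagkarogiannis, Comm. Math. Phys. 316 (2012) Thm 2.1.
-/

noncomputable section

namespace Summit.AtomisticToContinuum.HydrodynamicLimit.Theorems.NearConstantShortTimeHL

open scoped BigOperators ENNReal
open MeasureTheory Set Filter Topology Finset
open Literature.MathematicalPhysics.KineticTheory Literature.MathematicalPhysics.StatisticalMechanics
open Literature.Probability.LatticeModels
open Summit.AtomisticToContinuum.HydrodynamicLimit.Theorems.KineticWindowGronwallActivityInversion

/-! ## §1 The matched profile: Lipschitz constant of `β`, the empty class -/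

/-- **Lipschitz constant of the matched profile.** If `a(x) = ρ(x) Rf(σ³ρ(x))` with `Rf` `L_R`-Lipschitz and `≤ 2` on `[0, r]`,
`0 < ρ ≤ η/σ³` with `η ≤ r`, `ρ` `M`-Lipschitz and `1 ≤ ∫ a`, then `β = a/∫a` is `(2 + η L_R) M`-Lipschitz. [folklore] -/
theorem tlt_beta_lipschitz {a ρ : T3 → ℝ} (ha : Continuous a) (ha0 : ∀ x, 0 < a x) {Rf : ℝ → ℝ} {r : ℝ} {LR : NNReal}
    (hLR : LipschitzOnWith LR Rf (Icc 0 r)) (hbd : ∀ x ∈ Icc 0 r, 1 ≤ Rf x ∧ Rf x ≤ 2) {σ η M : ℝ} (hσ : 0 < σ)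
    (hηr : η ≤ r) (hρ0 : ∀ x, 0 < ρ x) (hρη : ∀ x, ρ x * σ ^ 3 ≤ η) (hM : 0 ≤ M)
    (hlip : ∀ x y, |ρ x - ρ y| ≤ M * dist x y) (haRf : ∀ x, a x = ρ x * Rf (σ ^ 3 * ρ x))
    (hIa : 1 ≤ ∫ y, a y) (x y : T3) :
    |(profileOf a ha ha0).β x - (profileOf a ha ha0).β y| ≤ (2 + η * LR) * M * dist x y := by
  have hσ3 : 0 < σ ^ 3 := pow_pos hσ 3
  have hmem : ∀ z, σ ^ 3 * ρ z ∈ Icc 0 r := fun z =>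
    ⟨(mul_pos hσ3 (hρ0 z)).le, by nlinarith [hρη z, hρ0 z]⟩
  have hρle : ∀ z, ρ z ≤ η / σ ^ 3 := fun z => by rw [le_div_iff₀ hσ3]; exact hρη z
  have hη0 : 0 ≤ η := (mul_pos (hρ0 x) hσ3).le.trans (hρη x)
  -- Lipschitz estimate for `a`
  have haxy : |a x - a y| ≤ (2 + η * LR) * M * dist x y := by
    rw [haRf x, haRf y]
    have h1 : |ρ x - ρ y| * Rf (σ ^ 3 * ρ x) ≤ M * dist x y * 2 :=
      mul_le_mul (hlip x y) (hbd _ (hmem x)).2 (zero_le_one.trans (hbd _ (hmem x)).1) (by positivity)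
    have h2 : |Rf (σ ^ 3 * ρ x) - Rf (σ ^ 3 * ρ y)| ≤ LR * (σ ^ 3 * |ρ x - ρ y|) := by
      have h := hLR.dist_le_mul (σ ^ 3 * ρ x) (hmem x) (σ ^ 3 * ρ y) (hmem y)
      rw [Real.dist_eq, Real.dist_eq, ← mul_sub, abs_mul, abs_of_pos hσ3] at h
      exact h
    have h3 : ρ y * |Rf (σ ^ 3 * ρ x) - Rf (σ ^ 3 * ρ y)| ≤ (η / σ ^ 3) * (LR * (σ ^ 3 * (M * dist x y))) := by
      refine mul_le_mul (hρle y) (h2.trans ?_) (abs_nonneg _) (by positivity)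
      exact mul_le_mul_of_nonneg_left (mul_le_mul_of_nonneg_left (hlip x y) hσ3.le) LR.coe_nonneg
    calc |ρ x * Rf (σ ^ 3 * ρ x) - ρ y * Rf (σ ^ 3 * ρ y)|
        = |(ρ x - ρ y) * Rf (σ ^ 3 * ρ x) + ρ y * (Rf (σ ^ 3 * ρ x) - Rf (σ ^ 3 * ρ y))| := by ring_nf
      _ ≤ |(ρ x - ρ y) * Rf (σ ^ 3 * ρ x)| + |ρ y * (Rf (σ ^ 3 * ρ x) - Rf (σ ^ 3 * ρ y))| := abs_add_le _ _
      _ = |ρ x - ρ y| * Rf (σ ^ 3 * ρ x) + ρ y * |Rf (σ ^ 3 * ρ x) - Rf (σ ^ 3 * ρ y)| := by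
          simp only [abs_mul, abs_of_pos (lt_of_lt_of_le one_pos (hbd _ (hmem x)).1), abs_of_pos (hρ0 y)]
      _ ≤ M * dist x y * 2 + (η / σ ^ 3) * (LR * (σ ^ 3 * (M * dist x y))) := add_le_add h1 h3
      _ = (2 + η * LR) * M * dist x y := by
          rw [show (η / σ ^ 3) * (LR * (σ ^ 3 * (M * dist x y))) = η * LR * M * dist x y * (σ ^ 3 / σ ^ 3) by ring,
            div_self hσ3.ne']
          ring
  -- divide by `∫ a ≥ 1`
  have hI : 0 < ∫ z, a z := lt_of_lt_of_le one_pos hIa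
  rw [profileOf_β, profileOf_β, ← sub_div, abs_div, abs_of_pos hI]
  calc |a x - a y| / ∫ z, a z ≤ |a x - a y| / 1 := div_le_div_of_nonneg_left (abs_nonneg _) one_pos hIa
    _ = |a x - a y| := div_one _
    _ ≤ (2 + η * LR) * M * dist x y := haxy

/-- The profile class `{ρ₁ : ∫ρ₁ = 1, ρ₁ σ³ ≤ η₁}` is empty when `η₁ < σ³`. [folklore] -/
theorem tlt_class_empty {σ η₁ : ℝ} (hσ : 0 < σ) (h : η₁ < σ ^ 3) {ρ₁ : T3 → ℝ} (hρc : Continuous ρ₁)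
    (hρ1 : (∫ x, ρ₁ x) = 1) (hbox : ∀ x, ρ₁ x * σ ^ 3 ≤ η₁) : False := by
  have hσ3 : 0 < σ ^ 3 := pow_pos hσ 3
  have hle : ∀ x, ρ₁ x ≤ η₁ / σ ^ 3 := fun x => by rw [le_div_iff₀ hσ3]; exact hbox x
  have h1 : (∫ x, ρ₁ x) ≤ ∫ _x : T3, η₁ / σ ^ 3 :=
    integral_mono (integrable_of_continuous_T3 hρc) (integrable_const _) hle
  rw [hρ1, integral_const, smul_eq_mul, probReal_univ, one_mul, le_div_iff₀ hσ3, one_mul] at h1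
  linarith

/-! ## §2 The registered helper -/

set_option maxHeartbeats 800000 in
/-- **`tl_contTilt_of : VarianceL2 → OnePointUniform → ContTiltLogLaplace`** (registered helper of crux
stmt-AtomisticToContinuum-12502, skeleton v16 of line `small-tilt-domination`): the log-Laplace bound for continuous tilts of
the matched canonical dilute hard-sphere gas from the L² variance bound and the uniform one-point limit. [cite: Yau1991, §2]
[cite: PulvirentiTsagkarogiannis2012, Thm 2.1] -/
theorem tl_contTilt_of : VarianceL2 → OnePointUniform → ContTiltLogLaplace := by
  intro hV hU
  obtain ⟨lamV, hlamV, KV, hKV, hVar⟩ := hV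
  obtain ⟨r, hr, Rf, hsol, hbd, hcont, ⟨LR, hLR⟩, huniq, η₂, hη₂, hη₂r, hexp⟩ := tlt_package
  -- universal constants
  have he1 : 0 < Real.exp 1 := Real.exp_pos 1
  have hv : 0 < v₁ := v₁_pos
  have hq4 : Real.exp (1 / 4) ≤ 3 := by
    have h := Real.exp_one_lt_d9
    have h1 : Real.exp (1 / 4) ≤ Real.exp 1 := Real.exp_le_exp.2 (by norm_num)
    linarith
  set lamW : ℝ := min lamV (1 / 2) with hlamW
  have hlamW0 : 0 < lamW := lt_min hlamV (by norm_num)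
  have hlamWV : lamW ≤ lamV := min_le_left _ _
  have hlamW1 : lamW < 1 := (min_le_right _ _).trans_lt (by norm_num)
  set lam : ℝ := 1 / (28 * Real.exp 1) with hlam
  have hlam0 : 0 < lam := by positivity
  have hlam14 : 2 * Real.exp 1 * lam ≤ 1 / 14 := by rw [hlam]; field_simp; norm_num
  set T := thresh r η₂ with hT
  have hT0 : 0 < T := thresh_pos hr hη₂
  have hT16 : T ≤ 1 / 16 := (min_le_left _ _).trans (min_le_right _ _)
  have hTr : T ≤ r := by
    have h1 : T ≤ η₂ / 2 := (min_le_left _ _).trans (min_le_left _ _)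
    linarith
  -- the packing threshold
  set η₁ : ℝ := min T (lamW / (12 * v₁)) with hη₁
  have hη₁0 : 0 < η₁ := lt_min hT0 (by positivity)
  have hη₁T : η₁ ≤ T := min_le_left _ _
  have hη₁W : η₁ ≤ lamW / (12 * v₁) := min_le_right _ _
  refine ⟨η₁, hη₁0, fun M hM σ hσ ε n hε hε0 hnε => ?_⟩
  have hσ3 : 0 < σ ^ 3 := pow_pos hσ 3
  set A : ℝ := 2 * η₁ / σ ^ 3 with hA
  have hA0 : 0 < A := by positivity
  set C₀ : ℝ := KV * (A * Real.exp (1 / 4)) with hC₀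
  have hC₀0 : 0 < C₀ := by positivity
  refine ⟨C₀, hC₀0, 1 / 8, by norm_num, fun γ hγ0 hγ8 κ hκ => ?_⟩
  -- the empty class
  by_cases hση : σ ^ 3 ≤ η₁
  swap
  · exact Eventually.of_forall fun N ρ₁ hρc hρ1 hbox _ G _ _ =>
      (tlt_class_empty hσ (lt_of_not_ge hση) hρc hρ1 (fun x => (hbox x).2)).elim
  have hσhalf : σ < 1 / 2 := by
    by_contra hcon
    have h1 : (1 / 2 : ℝ) ≤ σ := le_of_not_gt hcon
    have h2 : (1 / 2 : ℝ) ^ 3 ≤ σ ^ 3 := pow_le_pow_left₀ (by norm_num) h1 3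
    linarith [hη₁T.trans hT16]
  -- the family with positive particle numbers, for `OnePointUniform`
  set n' : ℕ → ℕ := fun N => max (n N) 1 with hn'
  haveI hn'inst : ∀ N, NeZero (n' N) := fun N => ⟨Nat.pos_iff_ne_zero.1 (lt_of_lt_of_le Nat.one_pos (le_max_right _ _))⟩
  have hnat : Tendsto n atTop atTop := gf_tendsto_atTop hσ hε hε0 hnε
  have hn'eq : ∀ᶠ N in atTop, n' N = n N := by
    filter_upwards [hnat.eventually_ge_atTop 1] with N hN
    exact max_eq_left hN
  have hn'ε : Tendsto (fun N => (n' N : ℝ) * ε N ^ 3) atTop (nhds (σ ^ 3)) := by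
    refine hnε.congr' ?_
    filter_upwards [hn'eq] with N hN
    rw [hN]
  set Lcls : ℝ := (2 + η₁ * LR) * M with hLcls
  have hU' := hU σ lam A Lcls hσ hσhalf hlam0 hlam14 ε n' hε hε0 hn'ε (4 * κ) (by positivity)
  -- the other eventual conditions
  have hev1 : ∀ᶠ N in atTop, ε N < 1 / 2 := hε0.eventually (gt_mem_nhds (by norm_num))
  have hev2 : ∀ᶠ N in atTop, 2 ≤ n N := hnat.eventually_ge_atTop 2
  have hev3 : ∀ᶠ N in atTop, (n N : ℝ) * ε N ^ 3 ≤ 2 * σ ^ 3 :=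
    (hnε.eventually (Iic_mem_nhds (by linarith))).mono fun N hN => hN
  filter_upwards [hU', hev1, hev2, hev3, hn'eq] with N hUN hεN hnN hnεN hn'N
  intro ρ₁ hρc hρ1 hbox hlip G hGc hG1
  -- the matched activity
  have hM0 : 0 ≤ M := zero_le_one.trans hM
  have hρpos : ∀ x, 0 < ρ₁ x := fun x => lt_of_lt_of_le (inv_pos.2 (lt_of_lt_of_le one_pos hM)) (hbox x).1
  have hpack : ∀ x, ρ₁ x * σ ^ 3 ≤ thresh r η₂ := fun x => (hbox x).2.trans hη₁T
  obtain ⟨-, hRf, ha, ha0, hab, hSD, hrho, hsmall⟩ :=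
    thermoActivity_spec hr hsol hbd hcont huniq hη₂ hexp hσ hρc hρpos hρ1 hpack
  set a := thermoActivity σ ρ₁ with ha_def
  set P := profileOf a ha ha0 with hP_def
  haveI : NeZero (n N) := ⟨by omega⟩
  have hεle : 0 ≤ ε N := (hε N).le
  have hGm : Measurable G := hGc.measurable
  -- bounds on the activity
  have hAa : ∀ x, a x ≤ A := by
    intro x
    have h1 := (hab x).2
    have h2 : ρ₁ x ≤ η₁ / σ ^ 3 := by rw [le_div_iff₀ hσ3]; exact (hbox x).2
    calc a x ≤ 2 * ρ₁ x := h1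
      _ ≤ 2 * (η₁ / σ ^ 3) := by linarith
      _ = A := by rw [hA]; ring
  have hIa : 1 ≤ ∫ y, a y :=
    calc (1 : ℝ) = ∫ y, ρ₁ y := hρ1.symm
      _ ≤ ∫ y, a y := integral_mono (integrable_of_continuous_T3 hρc) (integrable_of_continuous_T3 ha) fun x => (hab x).1
  -- tilted activities: smallness and positivity
  have hsmall_t : ∀ t ∈ Icc (0 : ℝ) γ,
      ((n N : ℕ) : ℝ) * pOv (profileOf (fun x => a x * Real.exp (t * G x))
        (LocalGibbsConcentration.continuous_tilt ha hGc t) (fun x => mul_pos (ha0 x) (Real.exp_pos _))) (ε N) ≤ lamW := by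
    intro t ht
    have hMt := tlt_tilt_profile_M_le ha ha0 hGc hG1 hAa hIa ht.1 (ht.2.trans hγ8)
    rw [pOv]
    calc ((n N : ℕ) : ℝ) * ((profileOf (fun x => a x * Real.exp (t * G x))
            (LocalGibbsConcentration.continuous_tilt ha hGc t) (fun x => mul_pos (ha0 x) (Real.exp_pos _))).M *
            v₁ * ε N ^ 3)
        = (profileOf (fun x => a x * Real.exp (t * G x))
            (LocalGibbsConcentration.continuous_tilt ha hGc t) (fun x => mul_pos (ha0 x) (Real.exp_pos _))).M *
            v₁ * ((n N : ℝ) * ε N ^ 3) := by ring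
      _ ≤ (A * Real.exp (1 / 4)) * v₁ * (2 * σ ^ 3) := by
          refine mul_le_mul (mul_le_mul_of_nonneg_right hMt hv.le) hnεN (by positivity) (by positivity)
      _ ≤ (A * 3) * v₁ * (2 * σ ^ 3) := by gcongr
      _ = 6 * v₁ * (A * σ ^ 3) := by ring
      _ = 12 * v₁ * η₁ := by rw [hA, div_mul_cancel₀ _ hσ3.ne']; ring
      _ ≤ 12 * v₁ * (lamW / (12 * v₁)) := by gcongr
      _ = lamW := by field_simp
  have hZ : ∀ t ∈ Icc (0 : ℝ) γ, 0 < posPartition (fun x => a x * Real.exp (t * G x)) (ε N) (n N) :=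
    fun t ht => tlt_posPartition_pos (LocalGibbsConcentration.continuous_tilt ha hGc t)
      (fun x => mul_pos (ha0 x) (Real.exp_pos _)) hεle hεN (hsmall_t t ht) hlamW1
  -- the derivative bound from `VarianceL2`
  set D : ℝ := C₀ * ∫ x, G x ^ 2 with hD_def
  have hG2int : 0 ≤ ∫ x, G x ^ 2 := integral_nonneg fun x => sq_nonneg _
  have hD : ∀ t ∈ Icc (0 : ℝ) γ,
      (∫ x, (((n N : ℕ) : ℝ)⁻¹ * ∑ i, G (x i)) * ∑ i, G (x i)
          ∂posGibbsMeasure (fun x => a x * Real.exp (t * G x)) (ε N) (n N)) -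
        (∫ x, ((n N : ℕ) : ℝ)⁻¹ * ∑ i, G (x i) ∂posGibbsMeasure (fun x => a x * Real.exp (t * G x)) (ε N) (n N)) *
          ∫ x, ∑ i, G (x i) ∂posGibbsMeasure (fun x => a x * Real.exp (t * G x)) (ε N) (n N) ≤ D := by
    intro t ht
    set bt : T3 → ℝ := fun x => a x * Real.exp (t * G x) with hbt
    have hbtc : Continuous bt := LocalGibbsConcentration.continuous_tilt ha hGc t
    have hbt0 : ∀ x, 0 < bt x := fun x => mul_pos (ha0 x) (Real.exp_pos _)
    set Pt := profileOf bt hbtc hbt0 with hPt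
    haveI : IsProbabilityMeasure (posGibbsMeasure bt (ε N) (n N)) :=
      isProbabilityMeasure_posGibbsMeasure_of_pos hbtc (fun x => (hbt0 x).le) (hZ t ht)
    have hSm : Measurable fun x : Fin (n N) → T3 => ∑ i, G (x i) := LocalGibbsConcentration.measurable_sum hGc _
    have hSK : ∀ x : Fin (n N) → T3, |∑ i, G (x i)| ≤ (n N) * 1 := fun x => LocalGibbsConcentration.abs_sum_le hG1 x
    rw [tlt_cov_eq_var (posGibbsMeasure bt (ε N) (n N)) hSm hSK, tlt_integral_avg_eq hbtc hbt0 (ε N) (n N) hGm hG1,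
      tlt_integral_var_eq hbtc hbt0 (ε N) (n N) G]
    have hV := hVar Pt (ε N) hεle hεN (n N) hnN ((hsmall_t t ht).trans hlamWV) G hGm hG1
    have hμ2 := tlt_integral_sq_μ_le Pt hGm hG1
    have hMt : Pt.M ≤ A * Real.exp (1 / 4) := tlt_tilt_profile_M_le ha ha0 hGc hG1 hAa hIa ht.1 (ht.2.trans hγ8)
    have hk : (0 : ℝ) < (n N : ℕ) := Nat.cast_pos.2 (Nat.pos_of_ne_zero (NeZero.ne _))
    calc ((n N : ℕ) : ℝ)⁻¹ * ((∫ x, (∑ i, G (x i) - (n N : ℕ) * (Md Pt (ε N) (n N) G (n N) / Xi Pt (ε N) (n N) (n N))) ^ 2 *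
            efR (Ov (ε N)) x univ ∂Measure.pi fun _ : Fin (n N) => Pt.μ) / Xi Pt (ε N) (n N) (n N))
        ≤ ((n N : ℕ) : ℝ)⁻¹ * (KV * (n N : ℕ) * ∫ y, G y ^ 2 ∂Pt.μ) :=
          mul_le_mul_of_nonneg_left hV (inv_nonneg.2 hk.le)
      _ = KV * ∫ y, G y ^ 2 ∂Pt.μ := by field_simp
      _ ≤ KV * (Pt.M * ∫ y, G y ^ 2) := mul_le_mul_of_nonneg_left hμ2 hKV.le
      _ ≤ KV * ((A * Real.exp (1 / 4)) * ∫ y, G y ^ 2) := by gcongr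
      _ = D := by rw [hD_def, hC₀]; ring
  -- the tilting inequality
  have hmain := tlt_exp_moment_le ha ha0 hGc hG1 (ε N) (n N) hγ0 hγ8 hZ hD
  -- the centring
  have hm0 : ∫ x, ((n N : ℕ) : ℝ)⁻¹ * ∑ i, G (x i) ∂posGibbsMeasure a (ε N) (n N) =
      Md P (ε N) (n N) G (n N) / Xi P (ε N) (n N) (n N) := tlt_integral_avg_eq ha ha0 (ε N) (n N) hGm hG1
  have hov : ovDensity P σ ≤ lam / 2 := by
    rw [ovDensity]
    have h1 : P.M * v₁ * σ ^ 3 ≤ 1 / (64 * Real.exp 1) := by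
      rw [le_div_iff₀ (by positivity)]
      have h2 : P.M * v₁ * σ ^ 3 * (64 * Real.exp 1) = 32 * (Real.exp 1 * (2 * P.M * v₁ * σ ^ 3)) := by ring
      rw [h2]; linarith
    refine h1.trans ?_
    rw [hlam, div_div]
    exact div_le_div_of_nonneg_left zero_le_one (by positivity) (by nlinarith [he1])
  have hMP : P.M ≤ A := by
    have h := tlt_profile_M_le ha ha0 hAa one_pos hIa
    rwa [div_one] at h
  have hLipP : ∀ x y, |P.β x - P.β y| ≤ Lcls * dist x y := fun x y =>
    tlt_beta_lipschitz ha ha0 hLR hbd hσ (hη₁T.trans hTr) hρpos (fun z => (hbox z).2) hM0 hlip hRf hIa x y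
  have hcent : |Md P (ε N) (n N) G (n N) / Xi P (ε N) (n N) (n N) - Ilim P σ G| ≤ 4 * κ := by
    have key : ∀ (k : ℕ) (_ : NeZero k), k = n N →
        |Md P (ε N) k G k / Xi P (ε N) k k - Ilim P σ G| ≤ 4 * κ →
        |Md P (ε N) (n N) G (n N) / Xi P (ε N) (n N) (n N) - Ilim P σ G| ≤ 4 * κ := by
      intro k _ hk h
      subst hk
      exact h
    exact key (n' N) inferInstance hn'N (hUN P hSD hov hMP hLipP G hGm hG1)
  have hIlim : Ilim P σ G = ∫ x, G x * ρ₁ x := by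
    rw [hSD.Ilim_eq_integral hGc, hrho]
  -- assembly of the exponent
  have hk0 : (0 : ℝ) ≤ (n N : ℕ) := Nat.cast_nonneg _
  have hexpo : ((n N : ℕ) : ℝ) * (γ * (∫ x, ((n N : ℕ) : ℝ)⁻¹ * ∑ i, G (x i) ∂posGibbsMeasure a (ε N) (n N)) + γ ^ 2 * D) ≤
      (n N : ℝ) * (γ * (∫ x, G x * ρ₁ x) + C₀ * γ ^ 2 * (∫ x, G x ^ 2) + κ) := by
    rw [hm0]
    refine mul_le_mul_of_nonneg_left ?_ hk0
    have h1 : Md P (ε N) (n N) G (n N) / Xi P (ε N) (n N) (n N) ≤ (∫ x, G x * ρ₁ x) + 4 * κ := by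
      have := (abs_le.1 hcent).2; linarith
    have h2 : γ * (Md P (ε N) (n N) G (n N) / Xi P (ε N) (n N) (n N)) ≤ γ * (∫ x, G x * ρ₁ x) + κ / 2 := by
      have h4 : 4 * γ * κ ≤ κ / 2 := by nlinarith
      calc γ * (Md P (ε N) (n N) G (n N) / Xi P (ε N) (n N) (n N)) ≤ γ * ((∫ x, G x * ρ₁ x) + 4 * κ) :=
            mul_le_mul_of_nonneg_left h1 hγ0.le
        _ = γ * (∫ x, G x * ρ₁ x) + 4 * γ * κ := by ring
        _ ≤ γ * (∫ x, G x * ρ₁ x) + κ / 2 := by linarith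
    have h5 : γ ^ 2 * D = C₀ * γ ^ 2 * ∫ x, G x ^ 2 := by rw [hD_def]; ring
    rw [h5]
    linarith
  -- from the Bochner to the Lebesgue integral
  have hprob : IsProbabilityMeasure (posGibbsMeasure a (ε N) (n N)) := by
    have h := hZ 0 ⟨le_rfl, hγ0.le⟩
    simp only [zero_mul, Real.exp_zero, mul_one] at h
    exact isProbabilityMeasure_posGibbsMeasure_of_pos ha (fun x => (ha0 x).le) h
  have hSm : Measurable fun x : Fin (n N) → T3 => ∑ i, G (x i) := LocalGibbsConcentration.measurable_sum hGc _
  have hfm : Measurable fun x : Fin (n N) → T3 => Real.exp (γ * ∑ i, G (x i)) := (measurable_const.mul hSm).exp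
  have hfK : ∀ x : Fin (n N) → T3, |Real.exp (γ * ∑ i, G (x i))| ≤ Real.exp (γ * (n N)) := by
    intro x
    rw [abs_of_pos (Real.exp_pos _), Real.exp_le_exp]
    have h := (abs_le.1 (LocalGibbsConcentration.abs_sum_le hG1 x)).2
    nlinarith
  have hint : Integrable (fun x : Fin (n N) → T3 => Real.exp (γ * ∑ i, G (x i))) (posGibbsMeasure a (ε N) (n N)) :=
    (integrable_const _).mono' hfm.aestronglyMeasurable (ae_of_all _ fun x => (Real.norm_eq_abs _).le.trans (hfK x))
  rw [← ofReal_integral_eq_lintegral_ofReal hint (ae_of_all _ fun x => (Real.exp_pos _).le)]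
  exact ENNReal.ofReal_le_ofReal (hmain.trans (Real.exp_le_exp.2 hexpo))

end Summit.AtomisticToContinuum.HydrodynamicLimit.Theorems.NearConstantShortTimeHL

end
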